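import Literature.NumberTheory.EllipticCurves.QuadraticTwist
import Literature.NumberTheory.EllipticCurves.QuadraticTwistJInvariantProofs
import Literature.NumberTheory.EllipticCurves.SzpiroOfAbcProofs
import Literature.NumberTheory.EllipticCurves.SzpiroLocalDataProofs
import Literature.NumberTheory.EllipticCurves.SzpiroFreyProofs
import Literature.NumberTheory.EllipticCurves.IntegralModelMinimalScalingProofs
import Summits.ABC.Analytic.RequirementsArchFloor
import HarnessLib

/-!
# Szpiro's inequality with exponent `3` on every quadratic-twist class

Record / BC5-class witness requested by the `abc-harv` desk (2026-08-28, crit-B's row (7) of the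
TRANSFER-FF dictionary census: "Szpiro with exponent 3 + C(class) on each quadratic-twist class is
provable now"), filed `--supports stmt-ABC-25422` (`PlaceCountSzpiro.PlaceBudgetSzpiro`, X1): the
statement below is X1's shape RESTRICTED TO ONE TWIST CLASS with `c = 1`, `K = 3`, `B = C(E₀)`.

**Theorem** (`quadraticTwistClass_szpiro_three`). For every elliptic curve `E₀/ℚ` (any Weierstrass
model `W₀`) there is a constant `C(E₀)` such that for every `d ∈ ℚˣ` and every elliptic curve `E/ℚ`
that is `ℚ`-isomorphic to the quadratic twist `E₀^{(d)}`,

`log |Δ_min(E)| ≤ 3 · log N_E + C(E₀)`.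

No congruence or coprimality condition on `d`; `C(E₀) = log (2¹⁸ |Δ(M)|⁷)` for any integral model
`M` of `E₀`.

**Proof.** Reduce `d` to a squarefree integer (`d ↦ d s²` does not change the class). For an
integral model `M` of `E₀` the curve `T_d : ⟨0, d b₂, 0, 8 d² b₄, 16 d³ b₆⟩ / ℤ` is an integral model
of `E₀^{(d)}` (it is the `u = ½` rescaling of the tree's `quadraticTwist`) with
`Δ(T_d) = 2¹² d⁶ Δ(M)` and `c₄(T_d) = 2⁴ d² c₄(M)`. Hence `|Δ_min(E)| ≤ 2¹² d⁶ |Δ(M)|`. At a prime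
`p ∣ d` with `p ∤ 2Δ(M)` one has `ord_p Δ(T_d) = 6 < 12`, so `T_d` is minimal at `p`, and
`p ∣ Δ, p ∣ c₄` gives additive reduction, `f_p ≥ 2`, `p² ∣ N_E` (Tate / Bombieri–Gubler 12.5.9(c),
tree `two_le_conductorExponent_of_dvd_Δ_of_dvd_c₄`). Writing `|d| = g · d'` with
`g = gcd(|d|, 2|Δ(M)|)` the cofactor `d'` is squarefree with all its primes of that kind, so
`d'² ∣ N_E`, `|d| ≤ 2|Δ(M)| · d'` and `|Δ_min(E)| ≤ 2¹² (2|Δ(M)|)⁶ |Δ(M)| · N_E³`.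

HONESTY. A per-class record: the constant depends on the class (on `Δ(E₀)`), which is exactly why
this is NOT polynomial Szpiro (A-PS, «NOT abc — POLY-SZPIRO(E)»), NOT abc, NOT A1′; abc distance 0;
it moves no rung of LADDER-ABC. The exponent `3` is sharp on a class (`N_{E^{(d)}} ≍ d²`,
`Δ_min ≍ d⁶` for `d` prime to `6N₀`, tree `conductorNorm_twistModel`).

References: Silverman, AEC VII.1 (Remark 1.1), VII.5, VIII.8, X.5 Cor. 5.4; Bombieri–Gubler
12.5.9; for the twist conductor `N₀ d²` see Comalada 1994 and the tree's
`TwistAmplificationSomeWindowSavingQuadraticTwistInvariants`.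
-/

-- `Summit.<Summit>.<Problem>` is the mandated summit-side namespace (CONVENTIONS §2); for the
-- single-conjunct summit `ABC` the two coincide, so the duplicate `ABC.ABC` is deliberate.
set_option linter.dupNamespace false

namespace Summit.ABC.ABC.Theorems

open WeierstrassCurve IsDedekindDomain Rat.HeightOneSpectrum
open Literature.NumberTheory.EllipticCurves

namespace QuadraticTwistClassSzpiro

/-! ### §1 Squarefree reduction of a rational twist parameter -/

/-- Every non-zero rational number is a squarefree integer times a non-zero rational square:
`q = d · s²`. [folklore] -/
theorem exists_squarefree_int_mul_sq (q : ℚ) (hq : q ≠ 0) :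
    ∃ (d : ℤ) (s : ℚ), Squarefree d ∧ s ≠ 0 ∧ q = d * s ^ 2 := by
  set n : ℤ := q.num * q.den with hn
  have hnum : q.num ≠ 0 := Rat.num_ne_zero.mpr hq
  have hden : (q.den : ℤ) ≠ 0 := by exact_mod_cast q.den_nz
  have hn0 : n ≠ 0 := mul_ne_zero hnum hden
  obtain ⟨a, b, hab, ha⟩ := Nat.sq_mul_squarefree n.natAbs
  have hb : b ≠ 0 := by
    rintro rfl
    simp only [ne_eq, zero_pow, OfNat.ofNat_ne_zero, not_false_eq_true, zero_mul] at hab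
    exact hn0 (Int.natAbs_eq_zero.mp hab.symm)
  refine ⟨n.sign * a, (b : ℚ) / q.den, ?_, ?_, ?_⟩
  · rw [← Int.squarefree_natAbs, Int.natAbs_mul, Int.natAbs_sign_of_ne_zero hn0, one_mul,
      Int.natAbs_natCast]
    exact ha
  · exact div_ne_zero (by exact_mod_cast hb) (by exact_mod_cast q.den_nz)
  · have h1 : (n : ℚ) = (n.sign : ℚ) * ((b : ℚ) ^ 2 * (a : ℚ)) := by
      have h := Int.sign_mul_natAbs n
      rw [← hab] at h
      have h' : (n : ℚ) = ((n.sign * ((b ^ 2 * a : ℕ) : ℤ) : ℤ) : ℚ) := by rw [h]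
      rw [h']
      push_cast
      ring
    have hn' : (n : ℚ) = q * (q.den : ℚ) ^ 2 := by
      rw [hn]; push_cast; rw [← Rat.mul_den_eq_num q]; ring
    have hdenQ : (q.den : ℚ) ≠ 0 := by exact_mod_cast q.den_nz
    rw [div_pow, ← mul_div_assoc, eq_div_iff (pow_ne_zero 2 hdenQ), ← hn', h1]
    push_cast
    ring

/-! ### §2 An integral model of the twist of an integral model

For `M / ℤ` and `d ∈ ℤ` put `T = ⟨0, d b₂(M), 0, 8 d² b₄(M), 16 d³ b₆(M)⟩ / ℤ`; it is the `u = ½`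
rescaling of `(M ⊗ ℚ)^{(d)}` (tree `WeierstrassCurve.quadraticTwist`). The model is passed as a
hypothesis `hT` to keep this a proof-only file. -/

variable {M T : WeierstrassCurve ℤ} {d : ℤ}

/-- `Δ(T) = 2¹² d⁶ Δ(M)` for the integral twist model. [folklore] -/
theorem twistInt_Δ (hT : T = ⟨0, d * M.b₂, 0, 8 * d ^ 2 * M.b₄, 16 * d ^ 3 * M.b₆⟩) :
    T.Δ = 2 ^ 12 * d ^ 6 * M.Δ := by
  subst hT
  simp only [WeierstrassCurve.Δ, WeierstrassCurve.b₂, WeierstrassCurve.b₄, WeierstrassCurve.b₆,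
    WeierstrassCurve.b₈]
  ring

/-- `c₄(T) = 2⁴ d² c₄(M)` for the integral twist model. [folklore] -/
theorem twistInt_c₄ (hT : T = ⟨0, d * M.b₂, 0, 8 * d ^ 2 * M.b₄, 16 * d ^ 3 * M.b₆⟩) :
    T.c₄ = 2 ^ 4 * d ^ 2 * M.c₄ := by
  subst hT
  simp only [WeierstrassCurve.c₄, WeierstrassCurve.b₂, WeierstrassCurve.b₄]
  ring

/-- The integral twist model is the `u = ½` rescaling of the quadratic twist `(M ⊗ ℚ)^{(d)}`:
`T ⊗ ℚ = (½, 0, 0, 0) • (M ⊗ ℚ)^{(d)}`. [folklore] -/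
theorem baseChange_twistInt (hT : T = ⟨0, d * M.b₂, 0, 8 * d ^ 2 * M.b₄, 16 * d ^ 3 * M.b₆⟩) :
    T.baseChange ℚ =
      (⟨(Units.mk0 (2 : ℚ) two_ne_zero)⁻¹, 0, 0, 0⟩ : VariableChange ℚ) •
        (M.baseChange ℚ).quadraticTwist (d : ℚ) := by
  subst hT
  ext
  · simp [baseChange, variableChange_a₁]
  · simp only [baseChange, map_a₂, variableChange_a₂, quadraticTwist_a₁, quadraticTwist_a₂,
      map_b₂, inv_inv, Units.val_mk0, eq_intCast, Int.cast_mul]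
    ring
  · simp [baseChange, variableChange_a₃]
  · simp only [baseChange, map_a₄, variableChange_a₄, quadraticTwist_a₁, quadraticTwist_a₂,
      quadraticTwist_a₃, quadraticTwist_a₄, map_b₄, inv_inv, Units.val_mk0, eq_intCast,
      Int.cast_mul, Int.cast_pow, Int.cast_ofNat]
    ring
  · simp only [baseChange, map_a₆, variableChange_a₆, quadraticTwist_a₁, quadraticTwist_a₂,
      quadraticTwist_a₃, quadraticTwist_a₄, quadraticTwist_a₆, map_b₆, inv_inv, Units.val_mk0,
      eq_intCast, Int.cast_mul, Int.cast_pow, Int.cast_ofNat]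
    ring

/-! ### §3 The conductor of the integral twist model

(`|Δ_min| ≤ |Δ(T)|` for the integral model `T` is the tree's
`Summit.ABC.Analytic.minimalDiscriminantNorm_baseChange_int_le_natAbs_Δ`, Silverman AEC VII.1 Remark 1.1.) -/

/-- For a prime `p`, a squarefree `d` and `p ∤ m`: `p¹² ∤ m d⁶` (the `p`-order is at most `6`).
[folklore] -/
theorem not_pow_twelve_dvd_mul_pow_six {p d m : ℤ} (hp : Prime p) (hsq : Squarefree d)
    (hm : ¬ p ∣ m) : ¬ p ^ 12 ∣ m * d ^ 6 := by
  intro h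
  have h6 : p ^ 12 ∣ d ^ 6 := hp.pow_dvd_of_dvd_mul_left 12 hm h
  have hp2 : ¬ p * p ∣ d := fun h2 ↦ hp.not_unit (hsq p h2)
  by_cases hpd : p ∣ d
  · obtain ⟨e, rfl⟩ := hpd
    have he : ¬ p ∣ e := fun he ↦ hp2 (mul_dvd_mul_left p he)
    have h' : p ^ 6 * p ^ 6 ∣ p ^ 6 * e ^ 6 := by
      simpa only [mul_pow, show (12 : ℕ) = 6 + 6 from rfl, pow_add] using h6
    have h'' : p ^ 6 ∣ e ^ 6 := (mul_dvd_mul_iff_left (pow_ne_zero 6 hp.ne_zero)).mp h'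
    exact he (hp.dvd_of_dvd_pow (dvd_trans (dvd_pow_self p (by norm_num)) h''))
  · exact hpd (hp.dvd_of_dvd_pow (dvd_trans (dvd_pow_self p (by norm_num)) h6))

/-- **Additive primes of the twist.** For the integral twist model `T` of `M` by a squarefree `d`
and a prime `p ∣ d` with `p ∤ 2Δ(M)`: `T` is minimal at `p` (`ord_p Δ(T) = 6 < 12`) with
`p ∣ Δ(T)`, `p ∣ c₄(T)` (additive reduction), so `f_p ≥ 2` and `p² ∣ N(T ⊗ ℚ)`
(Bombieri–Gubler 12.5.9(c); Silverman AEC VII.5, X.5). [cite: BombieriGubler2006, 12.5.9(c)] -/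
theorem sq_dvd_conductorNorm_twistInt [(T.baseChange ℚ).IsElliptic]
    (hT : T = ⟨0, d * M.b₂, 0, 8 * d ^ 2 * M.b₄, 16 * d ^ 3 * M.b₆⟩) (hsq : Squarefree d)
    {p : ℕ} (hp : p.Prime) (hpd : (p : ℤ) ∣ d) (hp2 : ¬ (p : ℤ) ∣ 2 * M.Δ) :
    p ^ 2 ∣ (T.baseChange ℚ).conductorNorm ℤ := by
  obtain ⟨v, hv⟩ := exists_place ⟨p, hp⟩
  simp only at hv
  have hpP : Prime (p : ℤ) := Nat.prime_iff_prime_int.mp hp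
  have hp2' : ¬ (p : ℤ) ∣ 2 := fun h ↦ hp2 (dvd_mul_of_dvd_left h _)
  have hpΔ : ¬ (p : ℤ) ∣ M.Δ := fun h ↦ hp2 (dvd_mul_of_dvd_right h _)
  have hm : ¬ (p : ℤ) ∣ 2 ^ 12 * M.Δ := fun h ↦
    (hpP.dvd_or_dvd h).elim (fun h2 ↦ hp2' (hpP.dvd_of_dvd_pow h2)) hpΔ
  have hmin : (T.baseChange ℚ).IsMinimalAt v := by
    refine isMinimalAt_baseChange_int_of_not_pow_dvd_Δ ?_
    rw [hv, twistInt_Δ hT, show (2 : ℤ) ^ 12 * d ^ 6 * M.Δ = 2 ^ 12 * M.Δ * d ^ 6 by ring]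
    exact not_pow_twelve_dvd_mul_pow_six hpP hsq hm
  have h2 : 2 ≤ (T.baseChange ℚ).conductorExponent v :=
    two_le_conductorExponent_of_dvd_Δ_of_dvd_c₄ hmin
      (by rw [hv, twistInt_Δ hT]; exact dvd_mul_of_dvd_left (dvd_mul_of_dvd_right
        (dvd_pow hpd (by norm_num)) _) _)
      (by rw [hv, twistInt_c₄ hT]; exact dvd_mul_of_dvd_left (dvd_mul_of_dvd_right
        (dvd_pow hpd (by norm_num)) _) _)
  have hfac := factorization_conductorNorm_primesEquiv_symm (T.baseChange ℚ) ⟨p, hp⟩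
  have hveq : (primesEquiv (R := ℤ)).symm ⟨p, hp⟩ = v :=
    (primesEquiv (R := ℤ)).symm_apply_eq.mpr (Subtype.ext hv.symm)
  rw [hveq] at hfac
  refine (hp.pow_dvd_iff_le_factorization (conductorNorm_pos_holds _).ne').mpr ?_
  rw [hfac]
  exact h2

/-- **The `2Δ(M)`-free part of `d` squared divides the conductor.** For the integral twist model
`T` of `M` by a squarefree `d`: with `g = gcd(|d|, |2Δ(M)|)` the cofactor `d' = |d| / g` satisfies
`d'² ∣ N(T ⊗ ℚ)` (every prime of `d'` is a prime of `d` not dividing `2Δ(M)`, and `d'` is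
squarefree). [folklore] -/
theorem cofactor_sq_dvd_conductorNorm [(T.baseChange ℚ).IsElliptic]
    (hT : T = ⟨0, d * M.b₂, 0, 8 * d ^ 2 * M.b₄, 16 * d ^ 3 * M.b₆⟩) (hsq : Squarefree d) :
    (d.natAbs / Nat.gcd d.natAbs (2 * M.Δ).natAbs) ^ 2 ∣ (T.baseChange ℚ).conductorNorm ℤ := by
  set A : ℕ := (2 * M.Δ).natAbs with hA
  set g : ℕ := Nat.gcd d.natAbs A with hg
  set d' : ℕ := d.natAbs / g with hd'
  have hsqN : Squarefree d.natAbs := Int.squarefree_natAbs.mpr hsq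
  have hdd : d' * g = d.natAbs := Nat.div_mul_cancel (Nat.gcd_dvd_left _ _)
  have hd'dvd : d' ∣ d.natAbs := ⟨g, hdd.symm⟩
  have hsq' : Squarefree d' := hsqN.squarefree_of_dvd hd'dvd
  have hd'0 : d' ≠ 0 := hsq'.ne_zero
  have hN0 : (T.baseChange ℚ).conductorNorm ℤ ≠ 0 := (conductorNorm_pos_holds _).ne'
  -- every prime of `d'` is a prime of `d` off `2Δ(M)`
  have hprime : ∀ p : ℕ, p.Prime → p ∣ d' → ¬ (p : ℤ) ∣ 2 * M.Δ := by
    intro p hp hpd' hpA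
    have hpA' : p ∣ A := Int.natCast_dvd.mp hpA
    have hpg : p ∣ g := Nat.dvd_gcd (dvd_trans hpd' hd'dvd) hpA'
    have hpp : p * p ∣ d.natAbs := hdd ▸ mul_dvd_mul hpd' hpg
    exact hp.ne_one (Nat.isUnit_iff.mp (hsqN p hpp))
  rw [← Nat.factorization_le_iff_dvd (pow_ne_zero 2 hd'0) hN0]
  intro p
  rw [Nat.factorization_pow]
  simp only [Finsupp.coe_smul, Pi.smul_apply, smul_eq_mul]
  by_cases hp : p.Prime
  · by_cases hpd' : p ∣ d'
    · rw [Nat.factorization_eq_one_of_squarefree hsq' hp hpd', mul_one]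
      exact (hp.pow_dvd_iff_le_factorization hN0).mp
        (sq_dvd_conductorNorm_twistInt hT hsq hp
          (Int.natCast_dvd.mpr (dvd_trans hpd' hd'dvd)) (hprime p hp hpd'))
    · rw [Nat.factorization_eq_zero_of_not_dvd hpd', mul_zero]
      exact Nat.zero_le _
  · rw [Nat.factorization_eq_zero_of_not_prime _ hp, mul_zero]
    exact Nat.zero_le _

/-- **Size bound.** For the integral twist model `T` of `M` by a squarefree `d`:
`|Δ_min(T ⊗ ℚ)| ≤ 2¹² · |2Δ(M)|⁶ · |Δ(M)| · N(T ⊗ ℚ)³`. [folklore] -/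
theorem minimalDiscriminantNorm_twistInt_le [(T.baseChange ℚ).IsElliptic]
    (hT : T = ⟨0, d * M.b₂, 0, 8 * d ^ 2 * M.b₄, 16 * d ^ 3 * M.b₆⟩) (hsq : Squarefree d) :
    (T.baseChange ℚ).minimalDiscriminantNorm ℤ ≤
      2 ^ 12 * (2 * M.Δ).natAbs ^ 6 * M.Δ.natAbs * ((T.baseChange ℚ).conductorNorm ℤ) ^ 3 := by
  set A : ℕ := (2 * M.Δ).natAbs with hA
  set g : ℕ := Nat.gcd d.natAbs A with hg
  set d' : ℕ := d.natAbs / g with hd'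
  set N : ℕ := (T.baseChange ℚ).conductorNorm ℤ with hN
  have hΔT : T.Δ ≠ 0 := Δ_ne_zero_of_isElliptic_baseChange_int T
  have hΔM : M.Δ ≠ 0 := by
    intro h; apply hΔT; rw [twistInt_Δ hT, h, mul_zero]
  have hA0 : A ≠ 0 := Int.natAbs_ne_zero.mpr (mul_ne_zero two_ne_zero hΔM)
  have hdd : d' * g = d.natAbs := Nat.div_mul_cancel (Nat.gcd_dvd_left _ _)
  have hgA : g ≤ A := Nat.le_of_dvd (Nat.pos_of_ne_zero hA0) (Nat.gcd_dvd_right _ _)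
  have hN0 : N ≠ 0 := (conductorNorm_pos_holds _).ne'
  have hd'N : d' ^ 2 ≤ N :=
    Nat.le_of_dvd (Nat.pos_of_ne_zero hN0) (cofactor_sq_dvd_conductorNorm hT hsq)
  calc (T.baseChange ℚ).minimalDiscriminantNorm ℤ
      ≤ T.Δ.natAbs := Summit.ABC.Analytic.minimalDiscriminantNorm_baseChange_int_le_natAbs_Δ T
    _ = 2 ^ 12 * (d' * g) ^ 6 * M.Δ.natAbs := by
        rw [twistInt_Δ hT, Int.natAbs_mul, Int.natAbs_mul, Int.natAbs_pow, Int.natAbs_pow, hdd]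
        norm_num
    _ ≤ 2 ^ 12 * (d' * A) ^ 6 * M.Δ.natAbs := by gcongr
    _ = 2 ^ 12 * A ^ 6 * M.Δ.natAbs * (d' ^ 2) ^ 3 := by ring
    _ ≤ 2 ^ 12 * A ^ 6 * M.Δ.natAbs * N ^ 3 := by gcongr

end QuadraticTwistClassSzpiro

open QuadraticTwistClassSzpiro in
/-- **Szpiro's inequality with exponent `3` on a quadratic-twist class** (record / BC5-class
witness; `--supports stmt-ABC-25422`: the shape of `PlaceBudgetSzpiro` on ONE twist class with
`c = 1`, `K = 3`, `B = C(E₀)`). For every elliptic curve `E₀/ℚ` (model `W₀`) there is `C` such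
that for every `d ∈ ℚˣ` and every elliptic `W/ℚ` that is `ℚ`-isomorphic to the quadratic twist
`W₀^{(d)}`: `log |Δ_min(W)| ≤ 3 · log N_W + C`. One may take `C = log (2¹⁸ |Δ(M)|⁷)` for any
integral model `M` of `E₀`. Per-class constant: NOT polynomial Szpiro (A-PS), NOT abc, no rung.
Silverman AEC VII.1, VII.5, VIII.8, X.5; Bombieri–Gubler 12.5.9. [folklore] -/
theorem quadraticTwistClass_szpiro_three (W₀ : WeierstrassCurve ℚ) [W₀.IsElliptic] :
    ∃ C : ℝ, ∀ (d : ℚ), d ≠ 0 → ∀ (W : WeierstrassCurve ℚ) [W.IsElliptic],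
      (∃ e : VariableChange ℚ, e • W = W₀.quadraticTwist d) →
        Real.log (W.minimalDiscriminantNorm ℤ : ℝ) ≤
          3 * Real.log (W.conductorNorm ℤ : ℝ) + C := by
  obtain ⟨C₀, M, hC₀, -⟩ := exists_baseChange_int_forall_isMinimalAt W₀
  haveI hMell : (M.baseChange ℚ).IsElliptic := by rw [← hC₀]; infer_instance
  have hΔM : M.Δ ≠ 0 := Δ_ne_zero_of_isElliptic_baseChange_int M
  set A : ℕ := (2 * M.Δ).natAbs with hA
  set K : ℕ := 2 ^ 12 * A ^ 6 * M.Δ.natAbs with hK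
  have hA0 : A ≠ 0 := Int.natAbs_ne_zero.mpr (mul_ne_zero two_ne_zero hΔM)
  have hK0 : K ≠ 0 := mul_ne_zero (mul_ne_zero (by norm_num) (pow_ne_zero 6 hA0))
    (Int.natAbs_ne_zero.mpr hΔM)
  refine ⟨Real.log K, fun d hd W _ ⟨e, he⟩ ↦ ?_⟩
  -- squarefree integer representative of the twist parameter
  obtain ⟨dz, s, hsq, hs, hdq⟩ := exists_squarefree_int_mul_sq d hd
  -- the integral twist model `T` and a `ℚ`-isomorphism `W ≅ T ⊗ ℚ`
  obtain ⟨T, hT⟩ : ∃ T : WeierstrassCurve ℤ,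
      T = ⟨0, dz * M.b₂, 0, 8 * dz ^ 2 * M.b₄, 16 * dz ^ 3 * M.b₆⟩ := ⟨_, rfl⟩
  obtain ⟨C', hC'⟩ : ∃ C' : VariableChange ℚ, C' • W = T.baseChange ℚ := by
    obtain ⟨C₁, hC₁⟩ := exists_variableChange_quadraticTwist_mul_sq W₀ (dz : ℚ) s hs
    have hW₀ : W₀ = C₀⁻¹ • M.baseChange ℚ := by rw [← hC₀, inv_smul_smul]
    set C₂ : VariableChange ℚ := ⟨(C₀⁻¹).u, (dz : ℚ) * (C₀⁻¹).r, 0, 0⟩ with hC₂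
    have htw : W₀.quadraticTwist (dz : ℚ) = C₂ • (M.baseChange ℚ).quadraticTwist (dz : ℚ) := by
      rw [hW₀, quadraticTwist_smul]
    have hTq := baseChange_twistInt hT
    refine ⟨(⟨(Units.mk0 (2 : ℚ) two_ne_zero)⁻¹, 0, 0, 0⟩ : VariableChange ℚ) * C₂⁻¹ * C₁⁻¹ * e,
      ?_⟩
    rw [mul_smul, mul_smul, mul_smul, he, hdq, ← hC₁, inv_smul_smul, htw, inv_smul_smul, hTq]
  haveI hTell : (T.baseChange ℚ).IsElliptic := by rw [← hC']; infer_instance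
  have hN : W.conductorNorm ℤ = (T.baseChange ℚ).conductorNorm ℤ := by
    rw [← hC', conductorNorm_smul_rat]
  have hD : W.minimalDiscriminantNorm ℤ = (T.baseChange ℚ).minimalDiscriminantNorm ℤ := by
    rw [← hC', minimalDiscriminantNorm_smul_rat]
  set N : ℕ := (T.baseChange ℚ).conductorNorm ℤ with hNdef
  have hN0 : N ≠ 0 := (conductorNorm_pos_holds _).ne'
  have hDle : (T.baseChange ℚ).minimalDiscriminantNorm ℤ ≤ K * N ^ 3 :=
    minimalDiscriminantNorm_twistInt_le hT hsq
  have hDpos : 0 < (T.baseChange ℚ).minimalDiscriminantNorm ℤ := minimalDiscriminantNorm_pos_holds _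
  rw [hD, hN]
  have hKpos : (0 : ℝ) < K := by exact_mod_cast Nat.pos_of_ne_zero hK0
  have hNpos : (0 : ℝ) < N := by exact_mod_cast Nat.pos_of_ne_zero hN0
  calc Real.log ((T.baseChange ℚ).minimalDiscriminantNorm ℤ : ℝ)
      ≤ Real.log ((K * N ^ 3 : ℕ) : ℝ) :=
        Real.log_le_log (by exact_mod_cast hDpos) (by exact_mod_cast hDle)
    _ = 3 * Real.log (N : ℝ) + Real.log (K : ℝ) := by
        push_cast
        rw [Real.log_mul hKpos.ne' (pow_ne_zero 3 hNpos.ne'), Real.log_pow]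
        push_cast
        ring

/-- The same record in the literal shape of `PlaceCountSzpiro.PlaceBudgetSzpiro` (X1,
stmt-ABC-25422) restricted to one twist class, with `c = 1`, `K = 3`, `B = C(E₀)`:
`log |Δ_min| ≤ 1 ^ ω(N) · (3 · log N + B)` for every curve in the class. A positioning remark
only — the class restriction is what X1 does NOT allow (NOT A-PS, NOT abc). [folklore] -/
theorem quadraticTwistClass_placeBudget_shape (W₀ : WeierstrassCurve ℚ) [W₀.IsElliptic] :
    ∃ B : ℝ, ∀ (d : ℚ), d ≠ 0 → ∀ (W : WeierstrassCurve ℚ) [W.IsElliptic],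
      (∃ e : VariableChange ℚ, e • W = W₀.quadraticTwist d) →
        Real.log (W.minimalDiscriminantNorm ℤ : ℝ) ≤
          (1 : ℝ) ^ (W.conductorNorm ℤ).primeFactors.card *
            (3 * Real.log (W.conductorNorm ℤ : ℝ) + B) := by
  obtain ⟨C, hC⟩ := quadraticTwistClass_szpiro_three W₀
  refine ⟨C, fun d hd W _ hW ↦ ?_⟩
  rw [one_pow, one_mul]
  exact hC d hd W hW

end Summit.ABC.ABC.Theorems
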